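/- Copyright: the b2b-balaban cell (near-miss cell 7), T⁴-continuum fan-out, NE7b CRUX team (2), leaf lineage
t4-ne7b-formalise-leaf-02 (gen 29; S12-W E-side lineage) under the row-NE7b OWNER's RULING R-OWNER-47-3 «THE LABEL GUARD»
(journal l.32219) in its gate-forced fallback (R-b) (journal l.32356: the (R-a) re-definition of `DisjointJoins` is
refused by the append-only rule «deprecate, don't mutate») — (R-b) twin L1.  Released under the licence of the
surrounding project. -/
import Summits.QuantumFields.BalabanUV.T4Continuum.Support.HistoryAssemblyMultInstanceW
import Summits.QuantumFields.BalabanUV.T4Continuum.Support.HistoryRealiseDistinctGuarded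

/-!
# History assembly, multiplicity socket: the display `hdis` of every live component FROM THE LABEL-GUARDED reading
clause `DisjointJoinsL` ((R-b) twin L1 of `HistoryRealiseDistinctValue.hdis_of_displays_valP` and
`HistoryAssemblyMultInstanceW.hdis_of_domainsRW` ∕ `hdisV_of_domainsRW`)

Summits-side support leaf of the T⁴-continuum cell (rung (B)+1 on a FINITE torus only; NOT infinite volume, NOT the
mass gap, NOT the Clay statement; NOT a proof of the spine estimate NE7b, which is the cell's OWN estimate, NOT PRINTED
and NOT PROVED).  [folklore] composition by name over `HistoryRealiseDistinctGuarded` (`DisjointJoinsL`,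
`hdis_of_displaysL` — p278855), `HistoryRealiseDistinctValue` (`valP`, `region_eq_of_valP_eq`),
`HistoryAssemblyMultInstanceW` (the W-twins' letters), leaf-05's zone-skeleton facts (`facts_of_realisesZ`,
`step_le_lastStep_of_realisesZ`, `realisesZ_of_realisesW`) and `HistoryJoinsPlacedMult` (`physV_eq_map`,
`untypeV_injective`, `side_pos`); no definition, no `[cite:]` tag, nothing printed asserted, zero `sorry`.

WHY.  Located finding F-ne7bleaf02g29-1 (journal l.32013; ADOPTED by R-OWNER-47-3): row S1c-opt's display
`DisjointJoins` has NO label guard and is FALSE on admissible pass-V inputs (kernel: `HistoryRealiseDistinctGuarded.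
Sanity.not_disjointJoins_nestedToy`), while every consumer uses it only under equal label.  The gate's append-only rule
forbids re-defining it ((R-a) refused, l.32356); the sanctioned road is deprecate-and-add: the guarded clause
`DisjointJoinsL` (landed) and, display by display, the twins of its consumers with the ONE binder `hDJ` retyped — this
file is the first: the multiplicity socket's `hdis` from `DisjointJoinsL` + `BoxedBirths`.  Downstream twins (END-B
`…MultEndDWTVL`, `…PinnedT3bWTVL`, witness `…WTVSL`, headline) consume it by name; the pass-V junction SUPPLIES the
retyped binder (`HistoryGenealogyJunctionVDistinct.InputFamily.disjointJoinsL_pedV`, IR-47-1′ part 3).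

WHAT.  §1 **`hdis_of_displays_valP_L`** — `DisjointJoinsL` + `BoxedBirths` + the three birth facts + `lv (step) ≤ K`,
`tcap d (fat) ≤ M` (`0 < L`) ⇒ the birth-VALUE multiset `(pbirths g).map (label, valP label payload)` is duplicate-free
(verbatim twin of `hdis_of_displays_valP` on `hdis_of_displaysL`).  §2 **`hdis_of_domainsRWL`** ∕ **`hdisV_of_domainsRWL`**
— `RealisedDomainsRW` + per live component `DisjointJoinsL` and `BoxedBirths` ⇒ `hdis` ∕ `(physV …).Nodup` (verbatim
twins of `hdis_of_domainsRW` ∕ `hdisV_of_domainsRW` with `hDJ` typed `DisjointJoinsL`).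

HONEST SCOPE.  Bookkeeping over OUR carriers; every H3-side item stays a HYPOTHESIS here (the junction discharges
`hDJ`∕`hBB` elsewhere); nothing of print asserted; by-name class of every `WALL-NE7b-P1.md` §2 binder unchanged except
the wording of `disjointJoins` («MISSTATED BINDER (unguarded) — guarded twin derived on pass V»); headline p224237 ∕ the
V∕VS headlines UNCHANGED BY NAME; NE7b NOT proved; spine 0∕9.  HONEST DEPENDENCY (cell): continuum YM on T⁴ ⇐
BetaPertH ∧ nine spine estimates (0/9 proved); BetaPertH ⇐ (D1) ∧ (D4) ∧ CAP+tail; G-an2-4 gates asym, D1 and NE2/3/4.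
Unchanged here. -/

open Finset
open Literature.MathematicalPhysics.QuantumFieldTheory.Balaban1983to89
open Literature.MathematicalPhysics.QuantumFieldTheory.Balaban1983to89.B13ScaleTransfer (Pt FaceConnected)
open Literature.MathematicalPhysics.QuantumFieldTheory.Balaban1983to89.B16SProfile (DropCtl)
open Literature.MathematicalPhysics.QuantumFieldTheory.Balaban1983to89.TreeLength (treeLen)
open T4PersistenceDictionary
open Summit.QuantumFields.BalabanUV.T4Continuum.ZoneTorus
open Summit.QuantumFields.BalabanUV.T4Continuum.ZoneSkeleton
open Summit.QuantumFields.BalabanUV.T4Continuum.HistoryZones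
open Summit.QuantumFields.BalabanUV.T4Continuum.HistoryAdmissible
open Summit.QuantumFields.BalabanUV.T4Continuum.HistoryRealise
open Summit.QuantumFields.BalabanUV.T4Continuum.HistoryRealiseCells
open Summit.QuantumFields.BalabanUV.T4Continuum.HistoryRealiseDistinct
open Summit.QuantumFields.BalabanUV.T4Continuum.HistoryRealiseDistinctGuarded
open Summit.QuantumFields.BalabanUV.T4Continuum.HistoryGen
open Summit.QuantumFields.BalabanUV.T4Continuum.HistoryRegionTemplates
open Summit.QuantumFields.BalabanUV.T4Continuum.HistoryJoinsTemplates
open Summit.QuantumFields.BalabanUV.T4Continuum.HistoryJoinsPlacedZone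
open Summit.QuantumFields.BalabanUV.T4Continuum.HistoryJoinsPlacedValue
open Summit.QuantumFields.BalabanUV.T4Continuum.HistoryJoinsPlacedMember
open Summit.QuantumFields.BalabanUV.T4Continuum.HistoryJoinsPlacedMult
open Summit.QuantumFields.BalabanUV.T4Continuum.HistoryRealiseWeak
open Summit.QuantumFields.BalabanUV.T4Continuum.HistoryRealiseWeakCells
open Summit.QuantumFields.BalabanUV.T4Continuum.HistoryAssemblyMultInstance
open Summit.QuantumFields.BalabanUV.T4Continuum.HistoryAssemblyMultInstanceW

/-! ## §1 The display-to-display form for `valP`, guarded clause -/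

namespace Summit.QuantumFields.BalabanUV.T4Continuum.HistoryRealiseDistinctGuarded

noncomputable section

variable {d : ℕ}

section Hdis

variable {n L K : ℕ} (hN : 0 < n * L ^ K) {lv : ℕ → ℕ} {M : ℕ} (hM : 1 ≤ M) {g : PGen (Pt d × Finset (Pt d))}

/-- **THE DISPLAY-TO-DISPLAY FORM FOR `valP`, GUARDED CLAUSE**: `DisjointJoinsL` + `BoxedBirths` + the three birth facts +
the per-birth side conditions `lv (step) ≤ K`, `tcap d (fat) ≤ M` (`0 < L`) ⇒ the birth-value multiset is duplicate-free
(twin of `HistoryRealiseDistinct.hdis_of_displays_valP` on `hdis_of_displaysL`). [folklore] -/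
theorem hdis_of_displays_valP_L (hL : 0 < L) (hd : DisjointJoinsL g) (hB : BoxedBirths n L K lv g)
    (hfacts : ∀ b ∈ g.pbirths, b.2.1 ∈ b.2.2 ∧ FaceConnected b.2.2 ∧ treeLen b.2.2 ≤ (PEv.fat b.1 : ℝ))
    (hK : ∀ b ∈ g.pbirths, lv (PEv.step b.1) ≤ K) (hcap : ∀ b ∈ g.pbirths, tcap d (PEv.fat b.1) ≤ M) :
    (g.pbirths.map (fun bz => (bz.1, valP n L K hN lv M hM bz.1 bz.2))).Nodup :=
  hdis_of_displaysL (valP n L K hN lv M hM) hd hB (fun b hb => (hfacts b hb).1)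
    (fun b hb b' hb' hl hbox hbox' _ _ hv => by
      have hp := hfacts b hb
      have hp' := hfacts b' hb'
      rw [← hl] at hp' hbox' hv
      exact region_eq_of_valP_eq hN hM hL (hK b hb) ⟨hp.1, hp.2.1, hp.2.2, hcap b hb⟩
        ⟨hp'.1, hp'.2.1, hp'.2.2, hcap b hb⟩ (hbox _ hp.1) (hbox' _ hp'.1) hv)

end Hdis

end

end Summit.QuantumFields.BalabanUV.T4Continuum.HistoryRealiseDistinctGuarded

/-! ## §2 The display `hdis` of every live component, memory-agnostic reading, guarded clause -/

namespace Summit.QuantumFields.BalabanUV.T4Continuum.HistoryAssemblyMultInstanceWL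

noncomputable section

open scoped Classical

section Hdis

variable {ι α π : Type*} [DecidableEq α] {d L n K₀ : ℕ} {s R : ℕ → ℕ → ℕ} {T : ℕ → Finset ι}
  {ped : ℕ → ι → Pedigree α π} {cellP : ℕ → ι → π → Pt d × Finset (Pt d)} {liveC : ℕ → ι → Finset α}
  {Zd : ℕ → ι → α → Finset (Pt d)}

/-- **T3b's DISPLAY `hdis` FOR EVERY LIVE COMPONENT FROM THE GUARDED CLAUSE** (twin of
`HistoryAssemblyMultInstanceW.hdis_of_domainsRW` with `hDJ` typed `DisjointJoinsL`): `RealisedDomainsRW` + per live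
component `DisjointJoinsL` and `BoxedBirths` (levels `levelOf (s K) K`) ⇒ the birth-VALUE multiset is duplicate-free,
for ANY template capacity `M K` holding the births' classes. [folklore] -/
theorem hdis_of_domainsRWL (hL : 0 < L) (hN : ∀ K, 0 < n * L ^ K) {M : ℕ → ℕ} (hM : ∀ K, 1 ≤ M K)
    (hs : ∀ K, K₀ ≤ K → ∀ t, t < K → s K (t + 1) ≤ s K t) (hdrop : ∀ K, K₀ ≤ K → DropCtl (s K) K)
    (H : RealisedDomainsRW L s n K₀ R T ped cellP liveC Zd)
    (hDJ : ∀ K, K₀ ≤ K → ∀ τ ∈ T K, ∀ c ∈ liveC K τ, DisjointJoinsL ((ped K τ).toPGen (cellP K τ) c))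
    (hBB : ∀ K, K₀ ≤ K → ∀ τ ∈ T K, ∀ c ∈ liveC K τ,
      BoxedBirths n L K (levelOf (s K) K) ((ped K τ).toPGen (cellP K τ) c))
    (hMf : ∀ K, K₀ ≤ K → ∀ τ ∈ T K, ∀ c ∈ liveC K τ, ∀ bz ∈ ((ped K τ).toPGen (cellP K τ) c).pbirths,
      tcap d bz.1.fat ≤ M K)
    {K : ℕ} (hK : K₀ ≤ K) {τ : ι} (hτ : τ ∈ T K) {c : α} (hc : c ∈ liveC K τ) :
    (((ped K τ).toPGen (cellP K τ) c).pbirths.map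
      fun bz => (bz.1, valP n L K (hN K) (levelOf (s K) K) (M K) (hM K) bz.1 bz.2)).Nodup := by
  obtain ⟨hre, hpend⟩ := H.real K hK τ hτ c hc
  have hreZ := realisesZ_of_realisesW _ _ hre
  have hlv : LevelFn K (levelOf (s K) K) := levelFn_levelOf (hs K hK) (hdrop K hK)
  refine HistoryRealiseDistinctGuarded.hdis_of_displays_valP_L (hN K) (hM K) hL (hDJ K hK τ hτ c hc)
    (hBB K hK τ hτ c hc) (fun b hb => facts_of_realisesZ hreZ hb) (fun b hb => ?_) (hMf K hK τ hτ c hc)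
  exact hlv.le_K _ ((step_le_lastStep_of_realisesZ _ _ hreZ b hb).trans hpend.1)

/-- **… IN THE LETTERS OF RECORD** `(physV …).Nodup`, guarded clause (twin of `hdisV_of_domainsRW`). [folklore] -/
theorem hdisV_of_domainsRWL (hL : 0 < L) (hn : 0 < n) {M : ℕ → ℕ} (hM : ∀ K, 1 ≤ M K)
    (hs : ∀ K, K₀ ≤ K → ∀ t, t < K → s K (t + 1) ≤ s K t) (hdrop : ∀ K, K₀ ≤ K → DropCtl (s K) K)
    (H : RealisedDomainsRW L s n K₀ R T ped cellP liveC Zd)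
    (hDJ : ∀ K, K₀ ≤ K → ∀ τ ∈ T K, ∀ c ∈ liveC K τ, DisjointJoinsL ((ped K τ).toPGen (cellP K τ) c))
    (hBB : ∀ K, K₀ ≤ K → ∀ τ ∈ T K, ∀ c ∈ liveC K τ,
      BoxedBirths n L K (levelOf (s K) K) ((ped K τ).toPGen (cellP K τ) c))
    (hMf : ∀ K, K₀ ≤ K → ∀ τ ∈ T K, ∀ c ∈ liveC K τ, ∀ bz ∈ ((ped K τ).toPGen (cellP K τ) c).pbirths,
      tcap d bz.1.fat ≤ M K)
    {K : ℕ} (hK : K₀ ≤ K) {τ : ι} (hτ : τ ∈ T K) {c : α} (hc : c ∈ liveC K τ) :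
    (physV n L hn hL M hM s ped cellP K τ c).Nodup := by
  rw [physV_eq_map]
  refine Multiset.Nodup.map (fun bv bv' h => ?_) (hdis_of_domainsRWL hL (side_pos hn hL) hM hs hdrop H hDJ hBB hMf hK hτ hc)
  simp only [Prod.mk.injEq] at h
  exact Prod.ext h.1 (untypeV_injective _ _ h.2)

end Hdis

end

end Summit.QuantumFields.BalabanUV.T4Continuum.HistoryAssemblyMultInstanceWL
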